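import Literature.Geometry.Lorentzian.VacuumLocalLimitFramed
import Literature.Geometry.Lorentzian.TameChartCompactnessFramedUnoriented
import Literature.Geometry.Lorentzian.SpacetimeLocalConvergenceOfChartsFramedFar
import Literature.Geometry.Lorentzian.KerrSchildFrame
import Literature.Geometry.Lorentzian.KerrDataProofs
import HarnessLib

/-!
# Local Cheeger–Gromov compactness near Kerr, down to and across the horizon

The framed local compactness theorem (`TameChartCompactnessFramed.lean`) specialised to the
Kerr–Schild frame `A = I + Hℓ⊗ℓ♯` on the chart domain `Kerr.region a r₀ = {r > max r₀ 0}`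
(`KerrSchildFrame.lean`), for `r₀ > 0` (so the region may reach inside the event horizon, but
stays off the ring singularity). Since Kerr read in `A⁻¹` is EXACTLY `η`
(`Kerr.framedBilin_bilin_ksFrame_Ainv`), the framed deviation of a chart `Ψ : Kerr.region a r₀ → 𝓢`
is its deviation from Kerr read in `A⁻¹` (`Spacetime.framedDeviation_ksFrame_eq`), hence is
controlled by the Kerr deviation `h = Ψ^*g − g_{M,a}` (`Spacetime.deviationExtend` for the
background `Kerr.regionBackground M a r₀`): `‖h̃‖ ≤ (1 + 2|M|/r₀)² ‖h‖` pointwise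
(`‖A⁻¹‖ ≤ 1 + 2|M|/r₀`, `Kerr.norm_ksFrame_Ainv_le`) and `Cᵏ` bounds on compacts transfer through
the smooth frame (`norm_iteratedFDeriv_framedBilin_le`).

**Theorem (`Spacetime.exists_nearKerrChart_subconvergesLocallyTo`).** Let `Ψₙ : Kerr.region a r₀ → 𝓢ₙ`
(`r₀ > 0`) be smooth injective charts of time-oriented Lorentzian 4-manifolds, centred
(`Ψₙ(y₀) = pₙ`), with `dΨₙ(A⁻¹∂₀)` future-directed at `y₀`, UNIFORMLY CLOSE TO KERR on the whole
region, `‖Ψₙ^*gₙ − g_{M,a}‖ ≤ θ/(1 + 2|M|/r₀)²` with `θ < 1`, and with Kerr deviations bounded in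
every `Cⁱ` on every compact subset uniformly in `n`. Then a subsequence converges, in the pointed
`Cᵏ_loc` sense for every `k`, to the near-framed chart spacetime `(Kerr.region a r₀, G, A⁻¹∂₀)` of
a smooth Lorentzian `G` with `‖A⁻¹*G − η‖ ≤ θ`, the components converging in every `Cᵏ_loc`; and
if all `𝓢ₙ` are Ricci-flat, so is the limit
(`Spacetime.exists_nearKerrChart_subconvergesLocallyTo_isRicciFlat`). No exterior/horizon
restriction and no gluing: an eternal single-chart limit through the horizon.

## References
* P. Petersen, *Riemannian Geometry*, 2nd ed., Springer 2006, Ch. 10 §3.2. [Petersen2006]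
* R. P. Kerr, A. Schild, 1965, §3; M. Visser, arXiv:0706.0622, (32)–(35). [KerrSchild1965]
-/

noncomputable section

open Set Filter TopologicalSpace Bundle Function
open scoped Manifold ContDiff Topology ENNReal

universe u

set_option synthInstance.maxHeartbeats 80000

set_option maxSynthPendingDepth 3

namespace Literature.Geometry.Lorentzian

/-- **`C⁰` size of a framed field**: `‖framedBilin F M (y)‖ ≤ ‖M(y)‖² ‖F(y)‖`. [folklore] -/
theorem norm_framedBilin_apply_le (F : E4 → E4 →L[ℝ] E4 →L[ℝ] ℝ) (M : E4 → E4 →L[ℝ] E4) (y : E4) :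
    ‖framedBilin F M y‖ ≤ ‖M y‖ ^ 2 * ‖F y‖ := by
  refine ContinuousLinearMap.opNorm_le_bound₂ _ (by positivity) fun v w ↦ ?_
  rw [framedBilin_apply]
  calc ‖F y (M y v) (M y w)‖ ≤ ‖F y‖ * ‖M y v‖ * ‖M y w‖ := ContinuousLinearMap.le_opNorm₂ _ _ _
    _ ≤ ‖F y‖ * (‖M y‖ * ‖v‖) * (‖M y‖ * ‖w‖) := by
        gcongr <;> exact ContinuousLinearMap.le_opNorm _ _
    _ = ‖M y‖ ^ 2 * ‖F y‖ * ‖v‖ * ‖w‖ := by ring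

namespace Kerr

/-- **The Kerr–Schild background on the chart domain `Kerr.region a r₀`**: Kerr–Schild form
`g_{M,a}`, time `t* = x⁰`, Kerr–Schild radius `r` (the tree's `Kerr.background M a` is the case of
the exterior `{r > r₊}`; here any `r₀`, e.g. inside the horizon). Reducible, so that charts
`Ψ : Kerr.region a r₀ → 𝓢` are charts on its domain syntactically up to reducible unfolding.
[cite: arXiv210408222, §1] -/
abbrev regionBackground (M a r₀ : ℝ) : ModelBackground where
  domain := region a r₀
  bilin := bilin M a
  time x := x 0
  radius := radius a

/-- The domain of the region background. [folklore] -/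
@[simp]
theorem regionBackground_domain (M a r₀ : ℝ) : (regionBackground M a r₀).domain = region a r₀ := rfl

/-- The reference metric of the region background. [folklore] -/
@[simp]
theorem regionBackground_bilin (M a r₀ : ℝ) : (regionBackground M a r₀).bilin = bilin M a := rfl

/-- The Kerr–Schild metric is smooth on `Kerr.region a r₀`. [cite: arXiv07060622, (32)–(35)] -/
theorem contDiffOn_bilin_region (M a r₀ : ℝ) {n : WithTop ℕ∞} :
    ContDiffOn ℝ n (bilin M a) (region a r₀ : Set E4) := fun _ hx ↦
  (contDiffAt_bilin M a (radius_pos_of_mem_region hx)).contDiffWithinAt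

end Kerr

namespace Spacetime

variable (𝓢 : Spacetime.{u} 4) {M a r₀ : ℝ}

/-- **The framed deviation in the Kerr–Schild frame is the Kerr deviation read in `A⁻¹`**:
`h̃ = A⁻¹*(Ψ^*g) − η = A⁻¹*(Ψ^*g − g_{M,a})` on `Kerr.region a r₀` (Kerr read in `A⁻¹` is `η`).
[cite: KerrSchild1965, §3] -/
theorem framedDeviation_ksFrame_eq (Ψ : Kerr.region a r₀ → 𝓢.carrier)
    (hΨ : ContMDiff 𝓘(ℝ, E4) (𝓡 4) ∞ Ψ) (z₀ : Kerr.region a r₀) {y : E4}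
    (hy : y ∈ (Kerr.region a r₀ : Set E4)) :
    𝓢.framedDeviation (Kerr.ksFrame M a r₀) Ψ z₀ y =
      framedBilin (𝓢.deviationExtend (Kerr.regionBackground M a r₀) Ψ) (Kerr.ksFrame M a r₀).Ainv y := by
  have hd : MDifferentiableAt 𝓘(ℝ, E4) (𝓡 4) Ψ ⟨y, hy⟩ := (hΨ ⟨y, hy⟩).mdifferentiableAt (by simp)
  have hm := 𝓢.metricInCoords_comp_chartAt_symm_eq_deviationExtend_add (Kerr.regionBackground M a r₀)
    Ψ z₀ hy hd
  have hK : ∀ v w : E4, Kerr.bilin M a y ((Kerr.ksFrame M a r₀).Ainv y v)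
      ((Kerr.ksFrame M a r₀).Ainv y w) = Minkowski.bilin v w := fun v w ↦
    Kerr.bilin_ksFrameInvMap M a (Kerr.radius_pos_of_mem_region hy) v w
  ext v w
  show framedBilin (𝓢.metricInCoords (Ψ ∘ (chartAt E4 z₀).symm)) (Kerr.ksFrame M a r₀).Ainv y v w -
      Minkowski.bilin v w = _
  rw [framedBilin_apply, framedBilin_apply, hm, add_apply, add_apply, Kerr.regionBackground_bilin, hK]
  ring

/-- The Kerr deviation of a smooth chart is smooth on the region. [folklore] -/
theorem contDiffOn_deviationExtend_regionBackground (Ψ : Kerr.region a r₀ → 𝓢.carrier)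
    (hΨ : ContMDiff 𝓘(ℝ, E4) (𝓡 4) ∞ Ψ) (z₀ : Kerr.region a r₀) {n : ℕ∞} :
    ContDiffOn ℝ n (𝓢.deviationExtend (Kerr.regionBackground M a r₀) Ψ) (Kerr.region a r₀ : Set E4) := by
  have h1 : ContDiffOn ℝ n (𝓢.metricInCoords (Ψ ∘ (chartAt E4 z₀).symm) - Kerr.bilin M a)
      (Kerr.region a r₀ : Set E4) :=
    ((𝓢.contDiffOn_metricInCoords (Kerr.region a r₀).2
      (𝓢.contMDiffOn_comp_chartAt_symm (Kerr.regionBackground M a r₀) Ψ z₀ hΨ)).of_le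
      (by exact_mod_cast le_top)).sub (Kerr.contDiffOn_bilin_region M a r₀)
  refine h1.congr fun y hy ↦ ?_
  exact (𝓢.deviationExtend_coe (Kerr.regionBackground M a r₀) Ψ ⟨y, hy⟩).trans
    (𝓢.metricInCoords_comp_chartAt_symm_sub_eq_deviation (Kerr.regionBackground M a r₀) Ψ z₀ hy
      ((hΨ ⟨y, hy⟩).mdifferentiableAt (by simp))).symm

/-- **Kerr pinching ⇒ framed pinching**: `‖h̃(y)‖ ≤ (1 + 2|M|/r₀)² ‖h(y)‖` on the region
(`r₀ > 0`). [cite: KerrSchild1965, §3] -/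
theorem norm_framedDeviation_ksFrame_le (hr₀ : 0 < r₀) (Ψ : Kerr.region a r₀ → 𝓢.carrier)
    (hΨ : ContMDiff 𝓘(ℝ, E4) (𝓡 4) ∞ Ψ) (z₀ : Kerr.region a r₀) {y : E4}
    (hy : y ∈ (Kerr.region a r₀ : Set E4)) :
    ‖𝓢.framedDeviation (Kerr.ksFrame M a r₀) Ψ z₀ y‖ ≤
      (1 + 2 * |M| / r₀) ^ 2 * ‖𝓢.deviationExtend (Kerr.regionBackground M a r₀) Ψ y‖ := by
  rw [𝓢.framedDeviation_ksFrame_eq Ψ hΨ z₀ hy]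
  refine (norm_framedBilin_apply_le _ _ y).trans ?_
  gcongr
  exact Kerr.norm_ksFrame_Ainv_le M hr₀ hy

variable {𝓢ₙ : ℕ → Spacetime.{u} 4}

/-- **`Cⁱ` bounds on compacts transfer from the Kerr deviations to the framed deviations**
(Leibniz through the smooth frame `A⁻¹`, `norm_iteratedFDeriv_framedBilin_le`). [folklore] -/
theorem exists_bound_iteratedFDeriv_framedDeviation_ksFrame
    (Ψ : ∀ n, Kerr.region a r₀ → (𝓢ₙ n).carrier) (hΨ : ∀ n, ContMDiff 𝓘(ℝ, E4) (𝓡 4) ∞ (Ψ n))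
    (z₀ : Kerr.region a r₀)
    (hb : ∀ (i : ℕ), ∀ K ⊆ (Kerr.region a r₀ : Set E4), IsCompact K → ∃ Λ : ℝ, ∀ n, ∀ z ∈ K,
      ‖iteratedFDeriv ℝ i ((𝓢ₙ n).deviationExtend (Kerr.regionBackground M a r₀) (Ψ n)) z‖ ≤ Λ)
    (i : ℕ) (K : Set E4) (hKO : K ⊆ (Kerr.region a r₀ : Set E4)) (hK : IsCompact K) :
    ∃ Λ : ℝ, ∀ n, ∀ z ∈ K,
      ‖iteratedFDeriv ℝ i ((𝓢ₙ n).framedDeviation (Kerr.ksFrame M a r₀) (Ψ n) z₀) z‖ ≤ Λ := by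
  obtain ⟨Θ, hΘ₁, hΘ⟩ := exists_bound_iteratedFDeriv_le_of_isCompact (Kerr.region a r₀).2
    ((Kerr.ksFrame M a r₀).contDiffOn_Ainv.of_le (by exact_mod_cast le_top) :
      ContDiffOn ℝ i (Kerr.ksFrame M a r₀).Ainv (Kerr.region a r₀ : Set E4)) hK hKO
  choose! Λ hΛ using fun j ↦ hb j K hKO hK
  have hN0 : 0 ≤ ∑ j ∈ Finset.range (i + 1), |Λ j| := Finset.sum_nonneg fun j _ ↦ abs_nonneg (Λ j)
  have hFb : ∀ n, ∀ z ∈ K, ∀ j, j ≤ i →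
      ‖iteratedFDeriv ℝ j ((𝓢ₙ n).deviationExtend (Kerr.regionBackground M a r₀) (Ψ n)) z‖ ≤
        ∑ j ∈ Finset.range (i + 1), |Λ j| := fun n z hz j hj ↦
    ((hΛ j n z hz).trans (le_abs_self _)).trans (Finset.single_le_sum (f := fun j ↦ |Λ j|)
      (fun j _ ↦ abs_nonneg (Λ j)) (Finset.mem_range.mpr (Nat.lt_succ_of_le hj)))
  refine ⟨4 ^ i * Θ ^ 2 * ∑ j ∈ Finset.range (i + 1), |Λ j|, fun n z hz ↦ ?_⟩
  have hDs : ContDiffOn ℝ i ((𝓢ₙ n).deviationExtend (Kerr.regionBackground M a r₀) (Ψ n))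
      (Kerr.region a r₀ : Set E4) :=
    ((𝓢ₙ n).contDiffOn_deviationExtend_regionBackground (Ψ n) (hΨ n) z₀ (n := i)).of_le
      (by exact_mod_cast le_rfl)
  -- the framed deviation agrees with `framedBilin h A⁻¹` near `z`
  have hgerm : (𝓢ₙ n).framedDeviation (Kerr.ksFrame M a r₀) (Ψ n) z₀ =ᶠ[𝓝 z]
      framedBilin ((𝓢ₙ n).deviationExtend (Kerr.regionBackground M a r₀) (Ψ n))
        (Kerr.ksFrame M a r₀).Ainv := by
    filter_upwards [(Kerr.region a r₀).2.mem_nhds (hKO hz)] with y hy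
    exact (𝓢ₙ n).framedDeviation_ksFrame_eq (Ψ n) (hΨ n) z₀ hy
  rw [(hgerm.iteratedFDeriv ℝ i).eq_of_nhds]
  exact norm_iteratedFDeriv_framedBilin_le (Kerr.region a r₀).2 hDs
    ((Kerr.ksFrame M a r₀).contDiffOn_Ainv.of_le (by exact_mod_cast le_top)) (hKO hz) hΘ₁ hN0
    (fun j hj ↦ hΘ j hj z hz) (fun j hj ↦ hFb n z hz j hj) le_rfl

variable {pₙ : ∀ n, (𝓢ₙ n).carrier}

/-- **Local Cheeger–Gromov compactness near Kerr, through the horizon** (module docstring).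
[cite: Petersen2006, Ch. 10 §3.2] -/
theorem exists_nearKerrChart_subconvergesLocallyTo (hr₀ : 0 < r₀) {y₀ : E4}
    (hy₀ : y₀ ∈ (Kerr.region a r₀ : Set E4)) (Ψ : ∀ n, Kerr.region a r₀ → (𝓢ₙ n).carrier)
    (hΨ : ∀ n, ContMDiff 𝓘(ℝ, E4) (𝓡 4) ∞ (Ψ n)) (hinj : ∀ n, Injective (Ψ n))
    (hcentre : ∀ n, Ψ n ⟨y₀, hy₀⟩ = pₙ n)
    (hfut : ∀ n, (𝓢ₙ n).timeOrientation.IsFutureDirected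
      (mfderiv 𝓘(ℝ, E4) (𝓡 4) (Ψ n) ⟨y₀, hy₀⟩ ((Kerr.ksFrame M a r₀).Ainv y₀ (E4.basisVector 0))))
    {θ : ℝ} (hθ : θ < 1)
    (hpinch : ∀ n, ∀ y ∈ (Kerr.region a r₀ : Set E4),
      ‖(𝓢ₙ n).deviationExtend (Kerr.regionBackground M a r₀) (Ψ n) y‖ ≤ θ / (1 + 2 * |M| / r₀) ^ 2)
    (hb : ∀ (i : ℕ), ∀ K ⊆ (Kerr.region a r₀ : Set E4), IsCompact K → ∃ Λ : ℝ, ∀ n, ∀ z ∈ K,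
      ‖iteratedFDeriv ℝ i ((𝓢ₙ n).deviationExtend (Kerr.regionBackground M a r₀) (Ψ n)) z‖ ≤ Λ) :
    ∃ (L : NearFramedChart (Kerr.region a r₀) (Kerr.ksFrame M a r₀)) (φ : ℕ → ℕ), StrictMono φ ∧
      (∀ y ∈ (Kerr.region a r₀ : Set E4), ‖L.framed.G y - Minkowski.bilin‖ ≤ θ) ∧
      (∀ (k : ℕ), ∀ K ⊆ (Kerr.region a r₀ : Set E4), IsCompact K →
        Tendsto (fun j ↦ supCkENorm K k
          ((𝓢ₙ (φ j)).metricInCoords (Ψ (φ j) ∘ (chartAt E4 (⟨y₀, hy₀⟩ : Kerr.region a r₀)).symm)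
            - L.G)) atTop (𝓝 0)) ∧
      ∀ k : ℕ, SubconvergesLocallyTo 𝓢ₙ pₙ
        (L.spacetime (Kerr.isConnected_region_holds a r₀)) ⟨y₀, hy₀⟩ k := by
  have hΘ : 0 < (1 + 2 * |M| / r₀) ^ 2 := by positivity
  have hpinch' : ∀ n, ∀ y ∈ (Kerr.region a r₀ : Set E4),
      ‖(𝓢ₙ n).framedDeviation (Kerr.ksFrame M a r₀) (Ψ n) ⟨y₀, hy₀⟩ y‖ ≤ θ := fun n y hy ↦ by
    refine ((𝓢ₙ n).norm_framedDeviation_ksFrame_le hr₀ (Ψ n) (hΨ n) ⟨y₀, hy₀⟩ hy).trans ?_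
    calc (1 + 2 * |M| / r₀) ^ 2 * ‖(𝓢ₙ n).deviationExtend (Kerr.regionBackground M a r₀) (Ψ n) y‖
        ≤ (1 + 2 * |M| / r₀) ^ 2 * (θ / (1 + 2 * |M| / r₀) ^ 2) := by gcongr; exact hpinch n y hy
      _ = θ := by field_simp
  obtain ⟨L, φ, hφ, hGpinch, _, hconvG, hsub⟩ :=
    exists_nearFramedChart_subconvergesLocallyTo_of_locallyBounded (Kerr.isConnected_region_holds a r₀)
      hy₀ Ψ hΨ hinj hcentre hfut hθ hpinch'
      (exists_bound_iteratedFDeriv_framedDeviation_ksFrame Ψ hΨ ⟨y₀, hy₀⟩ hb)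
  exact ⟨L, φ, hφ, hGpinch, hconvG, hsub⟩

/-- **Local Cheeger–Gromov compactness near Kerr for VACUUM spacetimes: the limit is vacuum**
(module docstring). [cite: Petersen2006, Ch. 10 §3.2] -/
theorem exists_nearKerrChart_subconvergesLocallyTo_isRicciFlat (hr₀ : 0 < r₀) {y₀ : E4}
    (hy₀ : y₀ ∈ (Kerr.region a r₀ : Set E4)) (Ψ : ∀ n, Kerr.region a r₀ → (𝓢ₙ n).carrier)
    (hΨ : ∀ n, ContMDiff 𝓘(ℝ, E4) (𝓡 4) ∞ (Ψ n)) (hinj : ∀ n, Injective (Ψ n))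
    (hcentre : ∀ n, Ψ n ⟨y₀, hy₀⟩ = pₙ n)
    (hfut : ∀ n, (𝓢ₙ n).timeOrientation.IsFutureDirected
      (mfderiv 𝓘(ℝ, E4) (𝓡 4) (Ψ n) ⟨y₀, hy₀⟩ ((Kerr.ksFrame M a r₀).Ainv y₀ (E4.basisVector 0))))
    {θ : ℝ} (hθ : θ < 1)
    (hpinch : ∀ n, ∀ y ∈ (Kerr.region a r₀ : Set E4),
      ‖(𝓢ₙ n).deviationExtend (Kerr.regionBackground M a r₀) (Ψ n) y‖ ≤ θ / (1 + 2 * |M| / r₀) ^ 2)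
    (hb : ∀ (i : ℕ), ∀ K ⊆ (Kerr.region a r₀ : Set E4), IsCompact K → ∃ Λ : ℝ, ∀ n, ∀ z ∈ K,
      ‖iteratedFDeriv ℝ i ((𝓢ₙ n).deviationExtend (Kerr.regionBackground M a r₀) (Ψ n)) z‖ ≤ Λ)
    (hvac : ∀ n, ∀ [(𝓢ₙ n).metric.toPseudoRiemannianMetric.HasLeviCivita],
      (𝓢ₙ n).metric.toPseudoRiemannianMetric.IsRicciFlat) :
    ∃ (L : NearFramedChart (Kerr.region a r₀) (Kerr.ksFrame M a r₀)) (φ : ℕ → ℕ), StrictMono φ ∧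
      (∀ y ∈ (Kerr.region a r₀ : Set E4), ‖L.framed.G y - Minkowski.bilin‖ ≤ θ) ∧
      (∀ (k : ℕ), ∀ K ⊆ (Kerr.region a r₀ : Set E4), IsCompact K →
        Tendsto (fun j ↦ supCkENorm K k
          ((𝓢ₙ (φ j)).metricInCoords (Ψ (φ j) ∘ (chartAt E4 (⟨y₀, hy₀⟩ : Kerr.region a r₀)).symm)
            - L.G)) atTop (𝓝 0)) ∧
      (∀ k : ℕ, SubconvergesLocallyTo 𝓢ₙ pₙ
        (L.spacetime (Kerr.isConnected_region_holds a r₀)) ⟨y₀, hy₀⟩ k) ∧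
      (∀ k : ℕ, SubconvergesLocallyWithFarChartsTo 𝓢ₙ pₙ
        (L.spacetime (Kerr.isConnected_region_holds a r₀)) ⟨y₀, hy₀⟩ k (Kerr.regionBackground M a r₀) Ψ
        (id : Kerr.region a r₀ → (L.spacetime (Kerr.isConnected_region_holds a r₀)).carrier)) ∧
      ∀ [(L.spacetime (Kerr.isConnected_region_holds a r₀)).metric.toPseudoRiemannianMetric.HasLeviCivita],
        (L.spacetime (Kerr.isConnected_region_holds a r₀)).metric.toPseudoRiemannianMetric.IsRicciFlat := by
  have hΘ : 0 < (1 + 2 * |M| / r₀) ^ 2 := by positivity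
  have hpinch' : ∀ n, ∀ y ∈ (Kerr.region a r₀ : Set E4),
      ‖(𝓢ₙ n).framedDeviation (Kerr.ksFrame M a r₀) (Ψ n) ⟨y₀, hy₀⟩ y‖ ≤ θ := fun n y hy ↦ by
    refine ((𝓢ₙ n).norm_framedDeviation_ksFrame_le hr₀ (Ψ n) (hΨ n) ⟨y₀, hy₀⟩ hy).trans ?_
    calc (1 + 2 * |M| / r₀) ^ 2 * ‖(𝓢ₙ n).deviationExtend (Kerr.regionBackground M a r₀) (Ψ n) y‖
        ≤ (1 + 2 * |M| / r₀) ^ 2 * (θ / (1 + 2 * |M| / r₀) ^ 2) := by gcongr; exact hpinch n y hy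
      _ = θ := by field_simp
  obtain ⟨L, φ, hφ, hGpinch, _, hconvG, hsub, hflat⟩ :=
    exists_nearFramedChart_subconvergesLocallyTo_isRicciFlat_of_locallyBounded
      (Kerr.isConnected_region_holds a r₀) hy₀ Ψ hΨ hinj hcentre hfut hθ hpinch'
      (exists_bound_iteratedFDeriv_framedDeviation_ksFrame Ψ hΨ ⟨y₀, hy₀⟩ hb) hvac
  refine ⟨L, φ, hφ, hGpinch, hconvG, hsub, fun k ↦ ?_, hflat⟩
  exact SubconvergesLocallyWithFarChartsTo.ofChartsFramed (Kerr.regionBackground M a r₀)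
    (Kerr.isConnected_region_holds a r₀) hy₀ Ψ hΨ hinj hcentre hfut
    (fun n y hy ↦ (hpinch' n y hy).trans_lt hθ) L hφ (hconvG k)

/-- **The limit is Kerr-close**: `‖L.G(y) − g_{M,a}(y)‖ ≤ (1 + 2|M|/r₀)² θ` on the region, for any
near-framed chart in the Kerr–Schild frame with `‖A⁻¹*G − η‖ ≤ θ` (read `A⁻¹*G − η` back in `A`).
[cite: KerrSchild1965, §3] -/
theorem _root_.Literature.Geometry.Lorentzian.NearFramedChart.norm_G_sub_kerr_le (hr₀ : 0 < r₀)
    (L : NearFramedChart (Kerr.region a r₀) (Kerr.ksFrame M a r₀)) {θ : ℝ}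
    (hL : ∀ y ∈ (Kerr.region a r₀ : Set E4), ‖L.framed.G y - Minkowski.bilin‖ ≤ θ) {y : E4}
    (hy : y ∈ (Kerr.region a r₀ : Set E4)) :
    ‖L.G y - Kerr.bilin M a y‖ ≤ (1 + 2 * |M| / r₀) ^ 2 * θ := by
  have h1 : L.G y - Kerr.bilin M a y =
      framedBilin (L.framed.G - fun _ ↦ Minkowski.bilin) (Kerr.ksFrame M a r₀).A y := by
    rw [framedBilin_sub, Pi.sub_apply, ← L.G_eq_framedBilin_framed hy,
      Kerr.framedBilin_minkowski_ksFrame_A M a r₀ hy]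
  rw [h1]
  refine (norm_framedBilin_apply_le _ _ y).trans ?_
  have hA : ‖(Kerr.ksFrame M a r₀).A y‖ ^ 2 ≤ (1 + 2 * |M| / r₀) ^ 2 :=
    pow_le_pow_left₀ (norm_nonneg _) (Kerr.norm_ksFrame_A_le M hr₀ hy) 2
  rw [Pi.sub_apply]
  have hn : 0 ≤ ‖L.framed.G y - Minkowski.bilin‖ := norm_nonneg (L.framed.G y - Minkowski.bilin)
  exact mul_le_mul hA (hL y hy) hn (by positivity)

/-! ### The exterior case in the tree's vocabulary `Kerr.background M a` -/

/-- `Kerr.background M a` is the region background with `r₀ = r₊` (`Kerr.exterior M a` is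
`Kerr.region a r₊` by definition). [cite: arXiv210408222, §1] -/
theorem _root_.Literature.Geometry.Lorentzian.Kerr.background_eq_regionBackground (M a : ℝ) :
    Kerr.background M a = Kerr.regionBackground M a (Kerr.rPlus M a) := rfl

/-- **Local Cheeger–Gromov compactness near the Kerr EXTERIOR** (charts on the domain of the
tree's `Kerr.background M a`, `r₊ > 0`): the case `r₀ = r₊` of
`exists_nearKerrChart_subconvergesLocallyTo_isRicciFlat`. [cite: Petersen2006, Ch. 10 §3.2] -/
theorem exists_nearKerrExteriorChart_subconvergesLocallyTo_isRicciFlat (hr : 0 < Kerr.rPlus M a)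
    {y₀ : E4} (hy₀ : y₀ ∈ ((Kerr.background M a).domain : Set E4))
    (Ψ : ∀ n, (Kerr.background M a).domain → (𝓢ₙ n).carrier)
    (hΨ : ∀ n, ContMDiff 𝓘(ℝ, E4) (𝓡 4) ∞ (Ψ n)) (hinj : ∀ n, Injective (Ψ n))
    (hcentre : ∀ n, Ψ n ⟨y₀, hy₀⟩ = pₙ n)
    (hfut : ∀ n, (𝓢ₙ n).timeOrientation.IsFutureDirected
      (mfderiv 𝓘(ℝ, E4) (𝓡 4) (Ψ n) ⟨y₀, hy₀⟩
        ((Kerr.ksFrame M a (Kerr.rPlus M a)).Ainv y₀ (E4.basisVector 0))))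
    {θ : ℝ} (hθ : θ < 1)
    (hpinch : ∀ n, ∀ y ∈ ((Kerr.background M a).domain : Set E4),
      ‖(𝓢ₙ n).deviationExtend (Kerr.background M a) (Ψ n) y‖ ≤
        θ / (1 + 2 * |M| / Kerr.rPlus M a) ^ 2)
    (hb : ∀ (i : ℕ), ∀ K ⊆ ((Kerr.background M a).domain : Set E4), IsCompact K →
      ∃ Λ : ℝ, ∀ n, ∀ z ∈ K,
        ‖iteratedFDeriv ℝ i ((𝓢ₙ n).deviationExtend (Kerr.background M a) (Ψ n)) z‖ ≤ Λ)
    (hvac : ∀ n, ∀ [(𝓢ₙ n).metric.toPseudoRiemannianMetric.HasLeviCivita],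
      (𝓢ₙ n).metric.toPseudoRiemannianMetric.IsRicciFlat) :
    ∃ (L : NearFramedChart (Kerr.exterior M a) (Kerr.ksFrame M a (Kerr.rPlus M a))) (φ : ℕ → ℕ),
      StrictMono φ ∧
      (∀ y ∈ (Kerr.exterior M a : Set E4), ‖L.framed.G y - Minkowski.bilin‖ ≤ θ) ∧
      (∀ (k : ℕ), ∀ K ⊆ (Kerr.exterior M a : Set E4), IsCompact K →
        Tendsto (fun j ↦ supCkENorm K k
          ((𝓢ₙ (φ j)).metricInCoords
              (Ψ (φ j) ∘ (chartAt E4 (⟨y₀, hy₀⟩ : (Kerr.background M a).domain)).symm) - L.G))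
          atTop (𝓝 0)) ∧
      (∀ k : ℕ, SubconvergesLocallyTo 𝓢ₙ pₙ
        (L.spacetime (Kerr.isConnected_region_holds a (Kerr.rPlus M a))) ⟨y₀, hy₀⟩ k) ∧
      (∀ k : ℕ, SubconvergesLocallyWithFarChartsTo 𝓢ₙ pₙ
        (L.spacetime (Kerr.isConnected_region_holds a (Kerr.rPlus M a))) ⟨y₀, hy₀⟩ k
        (Kerr.background M a) Ψ
        (id : (Kerr.background M a).domain →
          (L.spacetime (Kerr.isConnected_region_holds a (Kerr.rPlus M a))).carrier)) ∧
      ∀ [(L.spacetime (Kerr.isConnected_region_holds a (Kerr.rPlus M a))).metric.toPseudoRiemannianMetric.HasLeviCivita],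
        (L.spacetime (Kerr.isConnected_region_holds a
          (Kerr.rPlus M a))).metric.toPseudoRiemannianMetric.IsRicciFlat :=
  exists_nearKerrChart_subconvergesLocallyTo_isRicciFlat (r₀ := Kerr.rPlus M a) hr hy₀ Ψ hΨ hinj
    hcentre hfut hθ hpinch hb hvac

/-! ### No orientation hypothesis -/

/-- **Local Cheeger–Gromov compactness near Kerr, through the horizon, without orientation
hypothesis**: as `exists_nearKerrChart_subconvergesLocallyTo_isRicciFlat` but without assuming
`dΨₙ(A⁻¹∂₀)` future-directed (it is timelike by Kerr pinching, hence future- or past-directed along a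
subsequence); the limit is time-oriented by `A⁻¹∂₀` or by `−A⁻¹∂₀`, and is vacuum if the sources are.
[cite: Petersen2006, Ch. 10 §3.2] -/
theorem exists_nearKerrChart_subconvergesLocallyTo_unoriented_isRicciFlat (hr₀ : 0 < r₀) {y₀ : E4}
    (hy₀ : y₀ ∈ (Kerr.region a r₀ : Set E4)) (Ψ : ∀ n, Kerr.region a r₀ → (𝓢ₙ n).carrier)
    (hΨ : ∀ n, ContMDiff 𝓘(ℝ, E4) (𝓡 4) ∞ (Ψ n)) (hinj : ∀ n, Injective (Ψ n))
    (hcentre : ∀ n, Ψ n ⟨y₀, hy₀⟩ = pₙ n) {θ : ℝ} (hθ : θ < 1)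
    (hpinch : ∀ n, ∀ y ∈ (Kerr.region a r₀ : Set E4),
      ‖(𝓢ₙ n).deviationExtend (Kerr.regionBackground M a r₀) (Ψ n) y‖ ≤ θ / (1 + 2 * |M| / r₀) ^ 2)
    (hb : ∀ (i : ℕ), ∀ K ⊆ (Kerr.region a r₀ : Set E4), IsCompact K → ∃ Λ : ℝ, ∀ n, ∀ z ∈ K,
      ‖iteratedFDeriv ℝ i ((𝓢ₙ n).deviationExtend (Kerr.regionBackground M a r₀) (Ψ n)) z‖ ≤ Λ)
    (hvac : ∀ n, ∀ [(𝓢ₙ n).metric.toPseudoRiemannianMetric.HasLeviCivita],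
      (𝓢ₙ n).metric.toPseudoRiemannianMetric.IsRicciFlat) :
    ∃ (L : NearFramedChart (Kerr.region a r₀) (Kerr.ksFrame M a r₀)) (φ : ℕ → ℕ), StrictMono φ ∧
      (∀ y ∈ (Kerr.region a r₀ : Set E4), ‖L.framed.G y - Minkowski.bilin‖ ≤ θ) ∧
      (∀ (k : ℕ), ∀ K ⊆ (Kerr.region a r₀ : Set E4), IsCompact K →
        Tendsto (fun j ↦ supCkENorm K k
          ((𝓢ₙ (φ j)).metricInCoords (Ψ (φ j) ∘ (chartAt E4 (⟨y₀, hy₀⟩ : Kerr.region a r₀)).symm)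
            - L.G)) atTop (𝓝 0)) ∧
      ((∀ k : ℕ, SubconvergesLocallyTo 𝓢ₙ pₙ
          (L.spacetime (Kerr.isConnected_region_holds a r₀)) ⟨y₀, hy₀⟩ k) ∨
        (∀ k : ℕ, SubconvergesLocallyTo 𝓢ₙ pₙ
          (L.spacetime (Kerr.isConnected_region_holds a r₀)).reverse ⟨y₀, hy₀⟩ k)) ∧
      ∀ [(L.spacetime (Kerr.isConnected_region_holds a r₀)).metric.toPseudoRiemannianMetric.HasLeviCivita],
        (L.spacetime (Kerr.isConnected_region_holds a r₀)).metric.toPseudoRiemannianMetric.IsRicciFlat := by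
  have hΘ : 0 < (1 + 2 * |M| / r₀) ^ 2 := by positivity
  have hpinch' : ∀ n, ∀ y ∈ (Kerr.region a r₀ : Set E4),
      ‖(𝓢ₙ n).framedDeviation (Kerr.ksFrame M a r₀) (Ψ n) ⟨y₀, hy₀⟩ y‖ ≤ θ := fun n y hy ↦ by
    refine ((𝓢ₙ n).norm_framedDeviation_ksFrame_le hr₀ (Ψ n) (hΨ n) ⟨y₀, hy₀⟩ hy).trans ?_
    calc (1 + 2 * |M| / r₀) ^ 2 * ‖(𝓢ₙ n).deviationExtend (Kerr.regionBackground M a r₀) (Ψ n) y‖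
        ≤ (1 + 2 * |M| / r₀) ^ 2 * (θ / (1 + 2 * |M| / r₀) ^ 2) := by gcongr; exact hpinch n y hy
      _ = θ := by field_simp
  obtain ⟨L, φ, hφ, hGpinch, _, hconvG, hsub⟩ :=
    exists_nearFramedChart_subconvergesLocallyTo_of_locallyBounded_unoriented
      (Kerr.isConnected_region_holds a r₀) hy₀ Ψ hΨ hinj hcentre hθ hpinch'
      (exists_bound_iteratedFDeriv_framedDeviation_ksFrame Ψ hΨ ⟨y₀, hy₀⟩ hb)
  refine ⟨L, φ, hφ, hGpinch, hconvG, hsub, ?_⟩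
  intro _
  exact L.isRicciFlat_spacetime_of_tendsto (Kerr.isConnected_region_holds a r₀) Ψ hΨ ⟨y₀, hy₀⟩
    (fun n y hy ↦ (hpinch' n y hy).trans_lt hθ) hvac (φ := φ) fun y hy ↦
      hconvG 2 {y} (singleton_subset_iff.2 hy) isCompact_singleton

end Spacetime



end Literature.Geometry.Lorentzian

end
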